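import Mathlib
import HarnessLib
import Summits.ValiantsHypothesis.ValiantsHypothesis.Theorems.LacunarySymmetroidMatrixDescartesProductPlusOneTwoClusterCellEveryK
import Summits.ValiantsHypothesis.ValiantsHypothesis.Theorems.LacunarySymmetroidMatrixDescartesProductPlusOneRowTowerKMasterLaw

/-!
# LINE (A) `product_plus_one` — the CLUSTER CELL for every K: a knee cluster below, poles anywhere above (master law) + two-cluster rows + clouds

Support `d : Fin (n+2) → ℕ` (`StrictMono d`), rows `f_j = Σ_l C (a j l) X^{d l}`, window `(u,v)` (`0 < u`), threshold `p : ℕ`, `0 < p`.  THE MENU (per row):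
the two-cluster / cloud menu of ✓ `…TwoClusterCellEveryK`, OR a MASTER row: a cut `k`, one sign at letters `≤ k` (the KNEE CLUSTER: every two active
letters there — and every active letter against an active high letter's lower bound — within `p`: `l' ≤ k ⇒ d l' ≤ d l + p`), the other sign at letters `> k`
(the POLES, anywhere provided each is `≥ p` above every active knee letter), at least two active letters, and the window on the UNSWITCHED side
(`f_j` has the knee cluster's sign on `(u,v)`).  Law: ✓ `rowPsiK3_master_law` (`ψ₃ − p²ψ₁ − 6ψ₁² ≥ Σ_poles w_l φ_p(λ_l − τ) ≥ 0`), strict by a far pole or,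
when every pole sits at exactly `τ + p` (then there is at most one), by the two-cluster law.
THEN ★★ `clusterCellEveryK_wronskian_roots_le_two`: `W(∏_j f_j)` has AT MOST TWO roots in `(u,v)`; ★★ `clusterCellEveryK_eulerNumerator_roots_le_three`:
every `eulerNumerator d a l₀` (unfolded) has AT MOST THREE.  (Clouds are the master rows with `k = 0`; kept in the menu verbatim for continuity.)

Honest framing: ONE W-cell family (helper; every K); nothing closes a stub; the fast-knee cell (#19), `WronskianBudgetK3`, `OneChangeFloorK3`, `stub_classRowK3`,
`stub_polyLaw`, 18050 `MatrixDescartes`, Conjecture B are NOT proved; `VP ≠ VNP` NOT proved.  No definitions, no named facts.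
-/

set_option linter.dupNamespace false

namespace Summit.ValiantsHypothesis.ValiantsHypothesis.Theorems.LacunarySymmetroidMatrixDescartes

namespace ProductPlusOne

open Finset Set Polynomial
open scoped BigOperators Topology Polynomial

/-- ★ **ROW LAW, master row** (knees `≥ 0` up to the cut `k` within width `p`, poles `≤ 0` above it each `≥ p` above every active knee, at least two active
letters, `x > 0` with `f(x) > 0`): the stripped row is non-zero and `p²ψ₁ < ψ₃`. [this file's theorem] -/
theorem rowLawsAt_master_pos {n : ℕ} (d : Fin (n + 2) → ℕ) (hd : StrictMono d) (b : Fin (n + 2) → ℝ) (p : ℕ) (k : Fin (n + 2))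
    (hlow : ∀ l, l ≤ k → 0 ≤ b l) (hhigh : ∀ l, k < l → b l ≤ 0)
    (hact : ∃ l l', l ≠ l' ∧ b l ≠ 0 ∧ b l' ≠ 0)
    (hwidth : ∀ l l', b l ≠ 0 → b l' ≠ 0 → l' ≤ k → d l' ≤ d l + p)
    (hsep : ∀ l l', b l ≠ 0 → b l' ≠ 0 → l ≤ k → k < l' → d l + p ≤ d l')
    {x : ℝ} (hx0 : 0 < x) (hfx : 0 < (∑ l, C (b l) * X ^ (d l) : ℝ[X]).eval x) :
    b 0 - ∑ l : Fin (n + 1), (-(b l.succ)) * x ^ (d l.succ - d 0) ≠ 0 ∧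
    (p : ℝ) ^ 2 * rowPsiK1 (fun l : Fin (n + 1) => d l.succ - d 0) (b 0) (fun l : Fin (n + 1) => -(b l.succ)) x
      < rowPsiK3 (fun l : Fin (n + 1) => d l.succ - d 0) (b 0) (fun l : Fin (n + 1) => -(b l.succ)) x := by
  classical
  have hd0 : ∀ l, d 0 ≤ d l := fun l => hd.monotone (Fin.zero_le l)
  set lam : Fin (n + 1) → ℕ := fun l => d l.succ - d 0 with hlam
  set B : Fin (n + 1) → ℝ := fun l => -(b l.succ) with hBdef
  have hF : 0 < b 0 - ∑ l : Fin (n + 1), B l * x ^ (lam l) := by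
    rw [eval_rowK_eq d hd0 b x] at hfx
    exact (mul_pos_iff_of_pos_left (pow_pos hx0 _)).1 hfx
  refine ⟨hF.ne', ?_⟩
  have hk0 : (0 : Fin (n + 2)) ≤ k := Fin.zero_le k
  -- an active KNEE letter exists (else `f(x) ≤ 0`)
  have hknee : ∃ l, l ≤ k ∧ b l ≠ 0 := by
    by_contra hnone
    push Not at hnone
    have hle : (∑ l, C (b l) * X ^ (d l) : ℝ[X]).eval x ≤ 0 := by
      rw [eval_finsetSum]
      refine Finset.sum_nonpos fun l _ => ?_
      rw [eval_mul, eval_C, eval_pow, eval_X]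
      rcases le_or_gt l k with h | h
      · rw [hnone l h]; simp
      · exact mul_nonpos_of_nonpos_of_nonneg (hhigh l h) (pow_pos hx0 _).le
    linarith
  obtain ⟨l₂, hl₂k, hl₂⟩ := hknee
  obtain ⟨l₁, hl₁mem, hl₁max⟩ := Finset.exists_max_image (Finset.univ.filter fun l => l ≤ k ∧ b l ≠ 0) d
    ⟨l₂, Finset.mem_filter.2 ⟨Finset.mem_univ _, hl₂k, hl₂⟩⟩
  obtain ⟨hl₁k, hl₁⟩ := (Finset.mem_filter.1 hl₁mem).2
  have hmax : ∀ l, l ≤ k → b l ≠ 0 → d l ≤ d l₁ := fun l h1 h2 => hl₁max l (Finset.mem_filter.2 ⟨Finset.mem_univ _, h1, h2⟩)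
  set τ : ℕ := d l₁ - d 0 with hτ
  have hτle : d 0 ≤ d l₁ := hd0 l₁
  -- signs: a positive tail coefficient is a knee, a negative one is a pole
  have hkneeOf : ∀ l : Fin (n + 1), B l < 0 → l.succ ≤ k := by
    intro l hl
    by_contra h
    push Not at h
    have := hhigh l.succ h
    simp only [hBdef] at hl; linarith
  have hpoleOf : ∀ l : Fin (n + 1), 0 < B l → k < l.succ := by
    intro l hl
    by_contra h
    push Not at h
    have := hlow l.succ h
    simp only [hBdef] at hl; linarith
  have hBne : ∀ l : Fin (n + 1), B l ≠ 0 → b l.succ ≠ 0 := fun l hl => by simpa [hBdef] using hl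
  -- the master hypotheses
  have hA : 0 ≤ b 0 := hlow 0 hk0
  have h0 : b 0 ≠ 0 → τ ≤ p := by
    intro hb0
    have := hwidth 0 l₁ hb0 hl₁ hl₁k
    simp only [hτ]; omega
  have hlow' : ∀ l, B l < 0 → lam l ≤ τ ∧ τ ≤ lam l + p := by
    intro l hl
    have hlk := hkneeOf l hl
    have hbl := hBne l hl.ne
    have h1 := hmax l.succ hlk hbl
    have h2 := hwidth l.succ l₁ hbl hl₁ hl₁k
    have := hd0 l.succ
    constructor <;> simp only [hlam, hτ] <;> omega
  have hhigh' : ∀ l, 0 < B l → τ + p ≤ lam l := by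
    intro l hl
    have hlk := hpoleOf l hl
    have hbl := hBne l hl.ne'
    have := hsep l₁ l.succ hl₁ hbl hl₁k hlk
    have := hd0 l.succ
    simp only [hlam, hτ]; omega
  by_cases hfar : ∃ l, k < l ∧ b l ≠ 0 ∧ d l₁ + p < d l
  · obtain ⟨l, hlk, hbl, hdl⟩ := hfar
    obtain ⟨i, hi⟩ : ∃ i : Fin (n + 1), l = i.succ := by
      rcases Fin.eq_zero_or_eq_succ l with h | h
      · subst h; exact absurd hlk (not_lt.2 hk0)
      · exact h
    subst hi
    refine rowPsiK3_gt_of_master_far lam (b 0) B p τ hx0 hF hA h0 hlow' hhigh' ⟨i, ?_, ?_⟩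
    · have := hhigh i.succ hlk
      have hne : b i.succ ≠ 0 := hbl
      simp only [hBdef]
      rcases lt_or_eq_of_le this with h | h
      · linarith
      · exact absurd h hne
    · have := hd0 i.succ
      simp only [hlam, hτ]; omega
  · -- every pole sits at exactly `d l₁ + p`: the row is two-cluster
    push Not at hfar
    have hpoledeg : ∀ l, k < l → b l ≠ 0 → d l = d l₁ + p := by
      intro l hlk hbl
      have h1 := hfar l hlk hbl
      have h2 := hsep l₁ l hl₁ hbl hl₁k hlk
      omega
    have hwidth2 : ∀ l l', b l ≠ 0 → b l' ≠ 0 → (l' ≤ k ∨ k < l) → d l' ≤ d l + p := by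
      intro l l' hl hl' h
      rcases h with h | h
      · exact hwidth l l' hl hl' h
      · rcases le_or_gt l' k with h' | h'
        · have : d l' < d l := hd (lt_of_le_of_lt h' h)
          omega
        · rw [hpoledeg l h hl, hpoledeg l' h' hl']; omega
    exact (rowLawsAt_twoCluster_pos d hd b p k hlow hhigh hact hwidth2 hsep hx0 hfx.ne').2

/-- ★ **THE CLUSTER MENU ROW LAW**: a menu row (two-cluster / cloud / master, either sign pattern) has, on `(u,v)`, a non-vanishing stripped form and `p²ψ₁ < ψ₃`.
[this file's theorem] -/
theorem clusterRow_law {n : ℕ} (d : Fin (n + 2) → ℕ) (hd : StrictMono d) (b : Fin (n + 2) → ℝ) {u v : ℝ} (hu : 0 < u) (p : ℕ)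
    (hrowj :
      (((∃ k : Fin (n + 2),
        (((∀ l, l ≤ k → 0 ≤ b l) ∧ (∀ l, k < l → b l ≤ 0)) ∨ ((∀ l, l ≤ k → b l ≤ 0) ∧ (∀ l, k < l → 0 ≤ b l))) ∧
        (∃ l l', l ≠ l' ∧ b l ≠ 0 ∧ b l' ≠ 0) ∧
        (∀ l l', b l ≠ 0 → b l' ≠ 0 → (l' ≤ k ∨ k < l) → d l' ≤ d l + p) ∧
        (∀ l l', b l ≠ 0 → b l' ≠ 0 → l ≤ k → k < l' → d l + p ≤ d l') ∧
        (∀ x ∈ Ioo u v, (∑ l, C (b l) * X ^ (d l) : ℝ[X]).eval x ≠ 0)) ∨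
      ((∀ l : Fin (n + 1), b 0 * b l.succ ≤ 0) ∧ (∃ l : Fin (n + 1), b l.succ ≠ 0) ∧ (∀ l : Fin (n + 1), b l.succ ≠ 0 → p ≤ d l.succ - d 0) ∧
          0 < b 0 * (∑ l, C (b l) * X ^ (d l) : ℝ[X]).eval v)) ∨
      (∃ k : Fin (n + 2),
        (((∀ l, l ≤ k → 0 ≤ b l) ∧ (∀ l, k < l → b l ≤ 0) ∧ (∀ x ∈ Ioo u v, 0 < (∑ l, C (b l) * X ^ (d l) : ℝ[X]).eval x)) ∨
          ((∀ l, l ≤ k → b l ≤ 0) ∧ (∀ l, k < l → 0 ≤ b l) ∧ (∀ x ∈ Ioo u v, (∑ l, C (b l) * X ^ (d l) : ℝ[X]).eval x < 0))) ∧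
        (∃ l l', l ≠ l' ∧ b l ≠ 0 ∧ b l' ≠ 0) ∧
        (∀ l l', b l ≠ 0 → b l' ≠ 0 → l' ≤ k → d l' ≤ d l + p) ∧
        (∀ l l', b l ≠ 0 → b l' ≠ 0 → l ≤ k → k < l' → d l + p ≤ d l'))))
    {x : ℝ} (hx : x ∈ Ioo u v) :
    b 0 - ∑ l : Fin (n + 1), (-(b l.succ)) * x ^ (d l.succ - d 0) ≠ 0 ∧
    (p : ℝ) ^ 2 * rowPsiK1 (fun l : Fin (n + 1) => d l.succ - d 0) (b 0) (fun l : Fin (n + 1) => -(b l.succ)) x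
      < rowPsiK3 (fun l : Fin (n + 1) => d l.succ - d 0) (b 0) (fun l : Fin (n + 1) => -(b l.succ)) x := by
  have hx0 : 0 < x := hu.trans hx.1
  rcases hrowj with htwo | ⟨k, hsign, hact, hwidth, hsep⟩
  · exact twoClusterRow_law d hd b hu p htwo hx
  · rcases hsign with ⟨hlow, hhigh, hpos⟩ | ⟨hlow, hhigh, hneg⟩
    · exact rowLawsAt_master_pos d hd b p k hlow hhigh hact hwidth hsep hx0 (hpos x hx)
    · -- flip the row
      have hlow' : ∀ l, l ≤ k → 0 ≤ (fun l => -b l) l := fun l hl => by simp only; linarith [hlow l hl]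
      have hhigh' : ∀ l, k < l → (fun l => -b l) l ≤ 0 := fun l hl => by simp only; linarith [hhigh l hl]
      have hact' : ∃ l l', l ≠ l' ∧ (fun l => -b l) l ≠ 0 ∧ (fun l => -b l) l' ≠ 0 := by
        obtain ⟨l, l', hll', hl, hl'⟩ := hact; exact ⟨l, l', hll', neg_ne_zero.2 hl, neg_ne_zero.2 hl'⟩
      have hwidth' : ∀ l l', (fun l => -b l) l ≠ 0 → (fun l => -b l) l' ≠ 0 → l' ≤ k → d l' ≤ d l + p :=
        fun l l' hl hl' h => hwidth l l' (neg_ne_zero.1 hl) (neg_ne_zero.1 hl') h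
      have hsep' : ∀ l l', (fun l => -b l) l ≠ 0 → (fun l => -b l) l' ≠ 0 → l ≤ k → k < l' → d l + p ≤ d l' :=
        fun l l' hl hl' h1 h2 => hsep l l' (neg_ne_zero.1 hl) (neg_ne_zero.1 hl') h1 h2
      have hfx' : 0 < (∑ l, C ((fun l => -b l) l) * X ^ (d l) : ℝ[X]).eval x := by
        simp only
        rw [eval_rowK_neg d b x]; linarith [hneg x hx]
      exact (rowLawAt_neg_iff d b (p : ℝ) x).1 (rowLawsAt_master_pos d hd (fun l => -b l) p k hlow' hhigh' hact' hwidth' hsep' hx0 hfx')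

/-- ★★ **THE CLUSTER CELL FOR EVERY K**: `W(∏_j f_j)` has AT MOST TWO roots in `(u,v)`. [this file's theorem] -/
theorem clusterCellEveryK_wronskian_roots_le_two {m n : ℕ} (d : Fin (n + 2) → ℕ) (hd : StrictMono d)
    (a : Fin m → Fin (n + 2) → ℝ) {u v : ℝ} (hu : 0 < u) (p : ℕ) (hp : 0 < p)
    (hrow : ∀ j,
      (((∃ k : Fin (n + 2),
        (((∀ l, l ≤ k → 0 ≤ a j l) ∧ (∀ l, k < l → a j l ≤ 0)) ∨ ((∀ l, l ≤ k → a j l ≤ 0) ∧ (∀ l, k < l → 0 ≤ a j l))) ∧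
        (∃ l l', l ≠ l' ∧ a j l ≠ 0 ∧ a j l' ≠ 0) ∧
        (∀ l l', a j l ≠ 0 → a j l' ≠ 0 → (l' ≤ k ∨ k < l) → d l' ≤ d l + p) ∧
        (∀ l l', a j l ≠ 0 → a j l' ≠ 0 → l ≤ k → k < l' → d l + p ≤ d l') ∧
        (∀ x ∈ Ioo u v, (∑ l, C (a j l) * X ^ (d l) : ℝ[X]).eval x ≠ 0)) ∨
      ((∀ l : Fin (n + 1), a j 0 * a j l.succ ≤ 0) ∧ (∃ l : Fin (n + 1), a j l.succ ≠ 0) ∧ (∀ l : Fin (n + 1), a j l.succ ≠ 0 → p ≤ d l.succ - d 0) ∧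
          0 < a j 0 * (∑ l, C (a j l) * X ^ (d l) : ℝ[X]).eval v)) ∨
      (∃ k : Fin (n + 2),
        (((∀ l, l ≤ k → 0 ≤ a j l) ∧ (∀ l, k < l → a j l ≤ 0) ∧ (∀ x ∈ Ioo u v, 0 < (∑ l, C (a j l) * X ^ (d l) : ℝ[X]).eval x)) ∨
          ((∀ l, l ≤ k → a j l ≤ 0) ∧ (∀ l, k < l → 0 ≤ a j l) ∧ (∀ x ∈ Ioo u v, (∑ l, C (a j l) * X ^ (d l) : ℝ[X]).eval x < 0))) ∧
        (∃ l l', l ≠ l' ∧ a j l ≠ 0 ∧ a j l' ≠ 0) ∧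
        (∀ l l', a j l ≠ 0 → a j l' ≠ 0 → l' ≤ k → d l' ≤ d l + p) ∧
        (∀ l l', a j l ≠ 0 → a j l' ≠ 0 → l ≤ k → k < l' → d l + p ≤ d l')))) :
    (((∏ j, ∑ l, C (a j l) * X ^ (d l) : ℝ[X]) * (X * derivative (X * derivative (∏ j, ∑ l, C (a j l) * X ^ (d l) : ℝ[X])))
        - (X * derivative (∏ j, ∑ l, C (a j l) * X ^ (d l) : ℝ[X])) ^ 2).roots.toFinset.filter (fun t => u < t ∧ t < v)).card ≤ 2 :=
  wronskianK_roots_le_two_of_rowLawsAt d hd a hu p hp fun j _ hx => clusterRow_law d hd (a j) hu p (hrow j) hx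

/-- No menu row vanishes on the window. [this file's lemma] -/
theorem clusterCellEveryK_eval_ne_zero {m n : ℕ} (d : Fin (n + 2) → ℕ) (hd : StrictMono d)
    (a : Fin m → Fin (n + 2) → ℝ) {u v : ℝ} (hu : 0 < u) (p : ℕ)
    (hrow : ∀ j,
      (((∃ k : Fin (n + 2),
        (((∀ l, l ≤ k → 0 ≤ a j l) ∧ (∀ l, k < l → a j l ≤ 0)) ∨ ((∀ l, l ≤ k → a j l ≤ 0) ∧ (∀ l, k < l → 0 ≤ a j l))) ∧
        (∃ l l', l ≠ l' ∧ a j l ≠ 0 ∧ a j l' ≠ 0) ∧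
        (∀ l l', a j l ≠ 0 → a j l' ≠ 0 → (l' ≤ k ∨ k < l) → d l' ≤ d l + p) ∧
        (∀ l l', a j l ≠ 0 → a j l' ≠ 0 → l ≤ k → k < l' → d l + p ≤ d l') ∧
        (∀ x ∈ Ioo u v, (∑ l, C (a j l) * X ^ (d l) : ℝ[X]).eval x ≠ 0)) ∨
      ((∀ l : Fin (n + 1), a j 0 * a j l.succ ≤ 0) ∧ (∃ l : Fin (n + 1), a j l.succ ≠ 0) ∧ (∀ l : Fin (n + 1), a j l.succ ≠ 0 → p ≤ d l.succ - d 0) ∧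
          0 < a j 0 * (∑ l, C (a j l) * X ^ (d l) : ℝ[X]).eval v)) ∨
      (∃ k : Fin (n + 2),
        (((∀ l, l ≤ k → 0 ≤ a j l) ∧ (∀ l, k < l → a j l ≤ 0) ∧ (∀ x ∈ Ioo u v, 0 < (∑ l, C (a j l) * X ^ (d l) : ℝ[X]).eval x)) ∨
          ((∀ l, l ≤ k → a j l ≤ 0) ∧ (∀ l, k < l → 0 ≤ a j l) ∧ (∀ x ∈ Ioo u v, (∑ l, C (a j l) * X ^ (d l) : ℝ[X]).eval x < 0))) ∧
        (∃ l l', l ≠ l' ∧ a j l ≠ 0 ∧ a j l' ≠ 0) ∧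
        (∀ l l', a j l ≠ 0 → a j l' ≠ 0 → l' ≤ k → d l' ≤ d l + p) ∧
        (∀ l l', a j l ≠ 0 → a j l' ≠ 0 → l ≤ k → k < l' → d l + p ≤ d l'))))
    {x : ℝ} (hx : x ∈ Ioo u v) (j : Fin m) : (∑ l, C (a j l) * X ^ (d l) : ℝ[X]).eval x ≠ 0 := by
  have hd0 : ∀ l, d 0 ≤ d l := fun l => hd.monotone (Fin.zero_le l)
  have hx0 : 0 < x := hu.trans hx.1
  rw [eval_rowK_eq d hd0 (a j) x]
  exact mul_ne_zero (pow_ne_zero _ hx0.ne') (clusterRow_law d hd (a j) hu p (hrow j) hx).1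

/-- ★★ **THE CLUSTER CELL IN THE FLOOR'S CURRENCY**: for every coupling `l₀`, `eulerNumerator d a l₀` (unfolded) has AT MOST THREE zeros in `(u,v)`.
[this file's theorem] -/
theorem clusterCellEveryK_eulerNumerator_roots_le_three {m n : ℕ} (d : Fin (n + 2) → ℕ) (hd : StrictMono d)
    (a : Fin m → Fin (n + 2) → ℝ) (l₀ : Fin (n + 2)) {u v : ℝ} (hu : 0 < u) (p : ℕ) (hp : 0 < p)
    (hrow : ∀ j,
      (((∃ k : Fin (n + 2),
        (((∀ l, l ≤ k → 0 ≤ a j l) ∧ (∀ l, k < l → a j l ≤ 0)) ∨ ((∀ l, l ≤ k → a j l ≤ 0) ∧ (∀ l, k < l → 0 ≤ a j l))) ∧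
        (∃ l l', l ≠ l' ∧ a j l ≠ 0 ∧ a j l' ≠ 0) ∧
        (∀ l l', a j l ≠ 0 → a j l' ≠ 0 → (l' ≤ k ∨ k < l) → d l' ≤ d l + p) ∧
        (∀ l l', a j l ≠ 0 → a j l' ≠ 0 → l ≤ k → k < l' → d l + p ≤ d l') ∧
        (∀ x ∈ Ioo u v, (∑ l, C (a j l) * X ^ (d l) : ℝ[X]).eval x ≠ 0)) ∨
      ((∀ l : Fin (n + 1), a j 0 * a j l.succ ≤ 0) ∧ (∃ l : Fin (n + 1), a j l.succ ≠ 0) ∧ (∀ l : Fin (n + 1), a j l.succ ≠ 0 → p ≤ d l.succ - d 0) ∧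
          0 < a j 0 * (∑ l, C (a j l) * X ^ (d l) : ℝ[X]).eval v)) ∨
      (∃ k : Fin (n + 2),
        (((∀ l, l ≤ k → 0 ≤ a j l) ∧ (∀ l, k < l → a j l ≤ 0) ∧ (∀ x ∈ Ioo u v, 0 < (∑ l, C (a j l) * X ^ (d l) : ℝ[X]).eval x)) ∨
          ((∀ l, l ≤ k → a j l ≤ 0) ∧ (∀ l, k < l → 0 ≤ a j l) ∧ (∀ x ∈ Ioo u v, (∑ l, C (a j l) * X ^ (d l) : ℝ[X]).eval x < 0))) ∧
        (∃ l l', l ≠ l' ∧ a j l ≠ 0 ∧ a j l' ≠ 0) ∧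
        (∀ l l', a j l ≠ 0 → a j l' ≠ 0 → l' ≤ k → d l' ≤ d l + p) ∧
        (∀ l l', a j l ≠ 0 → a j l' ≠ 0 → l ≤ k → k < l' → d l + p ≤ d l')))) :
    ((∑ j, (∑ l, C (a j l * ((d l : ℝ) - d l₀)) * X ^ (d l)) * ∏ i ∈ Finset.univ.erase j, (∑ l, C (a i l) * X ^ (d l))
        : ℝ[X]).roots.toFinset.filter (fun t => u < t ∧ t < v)).card ≤ 3 := by
  classical
  refine roots_Ioo_card_le_of_Icc _ 3 fun u' v' hu' hv' => ?_
  rcases lt_or_ge v' u' with hvu | huv'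
  · have : ((∑ j, (∑ l, C (a j l * ((d l : ℝ) - d l₀)) * X ^ (d l)) * ∏ i ∈ Finset.univ.erase j, (∑ l, C (a i l) * X ^ (d l))
        : ℝ[X]).roots.toFinset.filter (fun t => u' ≤ t ∧ t ≤ v')) = ∅ :=
      Finset.filter_eq_empty_iff.2 fun t _ h => by linarith [h.1, h.2]
    rw [this]; simp
  have hu'0 : 0 < u' := hu.trans hu'
  have hP : ∀ t ∈ Set.Icc u' v', (∏ j, (∑ l, C (a j l) * X ^ (d l) : ℝ[X])).eval t ≠ 0 := by
    intro t ht
    rw [eval_prod]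
    exact Finset.prod_ne_zero_iff.2 fun j _ =>
      clusterCellEveryK_eval_ne_zero d hd a hu p hrow ⟨hu'.trans_le ht.1, ht.2.trans_lt hv'⟩ j
  have h1 := eulerNumerator_roots_Icc_le_wronskian_roots_add_one d a l₀ hu'0 hP
  have h2 := clusterCellEveryK_wronskian_roots_le_two d hd a hu p hp hrow
  have h3 : (((∏ j, ∑ l, C (a j l) * X ^ (d l) : ℝ[X]) * (X * derivative (X * derivative (∏ j, ∑ l, C (a j l) * X ^ (d l) : ℝ[X])))
            - (X * derivative (∏ j, ∑ l, C (a j l) * X ^ (d l) : ℝ[X])) ^ 2).roots.toFinset.filter (fun w => u' < w ∧ w < v')).card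
      ≤ (((∏ j, ∑ l, C (a j l) * X ^ (d l) : ℝ[X]) * (X * derivative (X * derivative (∏ j, ∑ l, C (a j l) * X ^ (d l) : ℝ[X])))
            - (X * derivative (∏ j, ∑ l, C (a j l) * X ^ (d l) : ℝ[X])) ^ 2).roots.toFinset.filter (fun t => u < t ∧ t < v)).card := by
    refine Finset.card_le_card fun t ht => ?_
    have ht' := Finset.mem_filter.1 ht
    exact Finset.mem_filter.2 ⟨ht'.1, hu'.trans ht'.2.1, ht'.2.2.trans hv'⟩
  omega

end ProductPlusOne

end Summit.ValiantsHypothesis.ValiantsHypothesis.Theorems.LacunarySymmetroidMatrixDescartes
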